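import Summits.BirchSwinnertonDyer.BirchSwinnertonDyer.Theorems.AlignedTransportAtTwoMainConjectureOfRankZeroBSDAtTwoHalfDescentLayerIndexCertificate
import HarnessLib

/-!
# Route `AlignedTransportAtTwo`, crux C2 `MainConjectureOfRankZeroBSDAtTwo` (stmt-BirchSwinnertonDyer-22298):
# THE GROWTH NUMBER WITHOUT GREENBERG 4.14, II — IWASAWA'S ONE-STEP GROWTH LAW, EXACT, FOR EVERY finitely generated torsion `Λ`-module `X` in a rank-`0` tower
# (finite submodule `F` PRESENT): `#(X/ω_{n+1}X) · #(F/ω_nF) = p^{pⁿ(p−1)μ + λ} · #(X/ω_nX) · #(F/ω_{n+1}F)`, i.e. `g_n = p^{pⁿ(p−1)μ+λ} · #(ω_nF/ω_{n+1}F)`;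
# `= p^{pⁿ(p−1)μ+λ}` EXACTLY as soon as `ω_n F = 0`; hence `e_n = μpⁿ + λn + ν` for ALL `n ≥ n₁` with `ν`, `n₁` explicit and NO «no finite submodule» hypothesis

HONEST FRAMING (cell `bsd-f1-sign2`, WIDTH-5 attached prover seat `bsd-line-att-p5` gen 56 on line `birth` of the lead `bsd-line-att-p2`;
`--supports` stmt-BirchSwinnertonDyer-22298, closes nothing; BSD is NOT proved by any of this; the crux C2, its verdict «blocked-on
`Rank1Residual.GreenbergMuConjectureIrreducible`» and every registered stub (P / T / Kμ / LimDoor / MuIneqʳ / PFμ⁺) are untouched). THEOREMS ONLY — pure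
commutative algebra over `Λ = ℤ_p⟦T⟧`, any prime `p`; no `def`, no instance, no named fact, no `sorry`. Companion of this gen's `…HalfDescentLayerIndexGrowth`
(`#(X/ω_{n+1}X) = #(X/ω_nX)·g_n`, `p^{pⁿ(p−1)μ} ∣ g_n ∣ #(X/Ψ_nX)` unconditionally); sequel of gen 54's `…HalfDescentLayerIndexTower` (Iwasawa's theorem EXACT
for modules WITHOUT finite submodule) and gen 55's `…HalfDescentLayerIndexFinite` (the layer quotient along `0 → F → X → X/F → 0`).

THE POINT. `X` f.g. torsion, `char_Λ X = (f)`, `F ≤ X` a finite submodule with `X' = X/F` free of finite submodules (the largest finite submodule; `char X' = (f)`),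
rank-`0` tower: `f(0) ≠ 0` and `Ψ_m ∤ f` (`m < n`) — then `ω_n` is `X'`-regular (gen 54 `omega_smul_eq_zero_imp`), so `F ∩ ω_nX = ω_nF` and
* §1 `natCard_quotient_omega_eq_mul`: **`#(X/ω_nX) = #(X'/ω_nX') · #(F/ω_nF)`** (gen 55's regular-quotient lemma);
* §2 with gen 54 (`#(X'/ω_{n+1}X') = #(X'/ω_nX')·#(X'/Ψ_nX')`, `#(X'/Ψ_nX') = p^{pⁿ(p−1)μ+λ}` for `λ(f) < pⁿ(p−1)`):
  ★★★ `natCard_quotient_omega_succ_mul_eq` **`#(X/ω_{n+1}X) · #(F/ω_nF) = p^{pⁿ(p−1)μ(f)+λ(f)} · #(X/ω_nX) · #(F/ω_{n+1}F)`** — the one-step growth number of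
  this gen's file I is `g_n = p^{pⁿ(p−1)μ+λ} · #(ω_nF/ω_{n+1}F)`: the finite submodule enters through the CORRECTION `#(ω_nF/ω_{n+1}F)`, which is `> 1` exactly
  while `ω_nF ≠ 0` (Nakayama) and `= 1` from the first `n` with `ω_nF = 0` on;
* §3 ★★★ `natCard_quotient_omega_succ_eq_pow_mul` — if moreover `ω_n F = 0`: **`#(X/ω_{n+1}X) = p^{pⁿ(p−1)μ(f)+λ(f)} · #(X/ω_nX)`** EXACTLY, for EVERY f.g. torsion
  `X` (finite submodule allowed): the growth number READS `(μ, λ)` with NO Prop. 4.14 binder;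
* §4 ★★★ `natCard_quotient_omega_mul_pow_eq'` — IWASAWA'S THEOREM for EVERY f.g. torsion `X` in a rank-`0` tower: with `n₁` such that `λ(f) < p^{n₁}(p−1)`,
  `Ψ_m ∤ f` (`m < n₁`) and `ω_{n₁}F = 0`, for all `n ≥ n₁`: **`#(X/ω_nX) · p^{μp^{n₁}+λn₁} = #(X/ω_{n₁}X) · p^{μpⁿ+λn}`** (`e_n = μpⁿ + λn + ν`, EXPLICIT `ν` and `n₁`;
  Washington Thm. 13.13 has «`n ≫ 0`» via the elementary model; gen 54 had it only for `F = 0`). A finite `F` IS killed by `ω_n` for `n ≫ 0` (gen 55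
  `…Eventual.exists_forall_omega_smul_eq_zero`; the `∃ n₁` form is in the sequel `…GrowthSelmer`, off this pure file).
Reading (`#(X/ω_nX) = #Sel_{p^∞}(E/K_∞)^{Γ_n}`): in a rank-`0` tower the invariants of the limit Selmer group grow by EXACTLY `p^{pⁿ(p−1)μ+λ}` per layer from an explicit
layer on, whatever the maximal finite submodule of `X(E/K_∞)` is; before that layer the growth is `p^{pⁿ(p−1)μ+λ}` times the visible factor `#(ω_nF/ω_{n+1}F)`.
What is NOT claimed: nothing about any curve; no `μ`, `λ` computed. Memo `Cruxes/MainConjectureOfRankZeroBSDAtTwo/LAYER-GROWTH-att-p5-g56.md`.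

References: K. Iwasawa, Bull. AMS 65 (1959); L. Washington, GTM 83, §13.3 (Lemmas 13.14–13.21, Thm. 13.13) [Washington1997]; J. Neukirch, A. Schmidt, K. Wingberg,
*Cohomology of Number Fields*, (5.3.17) [NeukirchSchmidtWingberg2008]; R. Greenberg, LNM 1716 (1999), Thm. 1.10, §4 p. 117, Prop. 4.14–4.15 [GreenbergLNM1716];
S. Lang, *Cyclotomic Fields I–II*, Ch. 5 Thm. 1.2 [Lang1990].
-/

set_option linter.dupNamespace false
set_option autoImplicit false

noncomputable section

open scoped Classical Polynomial

namespace Summit.BirchSwinnertonDyer.BirchSwinnertonDyer.Theorems.AlignedTransportAtTwoHalfDescentLayerIndexGrowthExact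

open Literature.NumberTheory.EllipticCurves Literature.NumberTheory.EllipticCurves.IwasawaAlgebra
  Summit.BirchSwinnertonDyer.Rank1Residual.X1.MuLambda
  Summit.BirchSwinnertonDyer.Rank1Residual.X1.GeneratorBoundMu
  Summit.BirchSwinnertonDyer.Rank1Residual.Iwasawa
  Summit.BirchSwinnertonDyer.BirchSwinnertonDyer.Theorems.DefectPrime
  Summit.BirchSwinnertonDyer.BirchSwinnertonDyer.Theorems.AlignedTransportAtTwoCyclotomicLayerPrime
  Summit.BirchSwinnertonDyer.BirchSwinnertonDyer.Theorems.AlignedTransportAtTwoHalfDescentLayerRing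
  Summit.BirchSwinnertonDyer.BirchSwinnertonDyer.Theorems.AlignedTransportAtTwoHalfDescentLayerIndex
  Summit.BirchSwinnertonDyer.BirchSwinnertonDyer.Theorems.AlignedTransportAtTwoHalfDescentLayerIndexModule
  Summit.BirchSwinnertonDyer.BirchSwinnertonDyer.Theorems.AlignedTransportAtTwoHalfDescentLayerIndexTower
  Summit.BirchSwinnertonDyer.BirchSwinnertonDyer.Theorems.AlignedTransportAtTwoHalfDescentLayerIndexFinite
  Summit.BirchSwinnertonDyer.BirchSwinnertonDyer.Theorems.AlignedTransportAtTwoHalfDescentLayerIndexCertificate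

universe u

variable {p : ℕ} [hp : Fact p.Prime] {M : Type u} [AddCommGroup M] [Module (IwasawaAlgebra p) M]

/-! ## §0 Bookkeeping: `Ψ_m ∤ f` above the first high layer; `ω`-annihilation propagates up the tower -/

/-- If `λ(f) < p^{n₀}(p−1)` then `Ψ_m ∤ f` for every `m ≥ n₀` (`λ(Ψ_m) = p^m(p−1)` and `λ` is additive). [cite: Washington1997, §7.1 and §13.3] -/
theorem not_cyclotomicLayer_dvd_of_lam_lt {f : IwasawaAlgebra p} (hf0 : f ≠ 0) {n₀ : ℕ} (hlam : lam f < p ^ n₀ * (p - 1)) {m : ℕ} (hm : n₀ ≤ m) :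
    ¬ ((((Polynomial.cyclotomic (p ^ (m + 1)) ℤ_[p]).comp (Polynomial.X + 1) : ℤ_[p][X]) : IwasawaAlgebra p) ∣ f) := by
  rintro ⟨q, hq⟩
  have hq0 : q ≠ 0 := fun h ↦ hf0 (by rw [hq, h, mul_zero])
  have hl := lam_mul (prime_coe_cyclotomic_comp p m).ne_zero hq0
  rw [← hq, lam_cyclotomicLayer] at hl
  have hmono : p ^ n₀ * (p - 1) ≤ p ^ m * (p - 1) := Nat.mul_le_mul_right _ (Nat.pow_le_pow_right hp.out.pos hm)
  omega

/-- `Ψ_m ∤ f` for ALL `m`, given it below `n₀` and `λ(f) < p^{n₀}(p−1)`. [cite: Washington1997, §13.3] -/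
theorem forall_not_cyclotomicLayer_dvd {f : IwasawaAlgebra p} (hf0 : f ≠ 0) {n₀ : ℕ} (hlam : lam f < p ^ n₀ * (p - 1))
    (hΨ : ∀ m < n₀, ¬ ((((Polynomial.cyclotomic (p ^ (m + 1)) ℤ_[p]).comp (Polynomial.X + 1) : ℤ_[p][X]) : IwasawaAlgebra p) ∣ f)) (m : ℕ) :
    ¬ ((((Polynomial.cyclotomic (p ^ (m + 1)) ℤ_[p]).comp (Polynomial.X + 1) : ℤ_[p][X]) : IwasawaAlgebra p) ∣ f) := by
  by_cases h : m < n₀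
  · exact hΨ m h
  · exact not_cyclotomicLayer_dvd_of_lam_lt hf0 hlam (Nat.le_of_not_lt h)

/-- `ω`-annihilation propagates: if `ω_k` kills a submodule `F` then so does `ω_n` for every `n ≥ k` (`ω_{n+1} = Ψ_n · ω_n`). [cite: Washington1997, §13.2] -/
theorem omega_smul_eq_zero_of_le (F : Submodule (IwasawaAlgebra p) M) {k : ℕ}
    (hk : ∀ x ∈ F, (((1 + PowerSeries.X : PowerSeries ℤ_[p]) ^ (p ^ k) - 1 : IwasawaAlgebra p)) • x = 0) {n : ℕ} (hkn : k ≤ n) :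
    ∀ x ∈ F, (((1 + PowerSeries.X : PowerSeries ℤ_[p]) ^ (p ^ n) - 1 : IwasawaAlgebra p)) • x = 0 := by
  induction n, hkn using Nat.le_induction with
  | base => exact hk
  | succ n _ ih =>
    intro x hx
    rw [← coe_cyclotomicLayer_mul_omega p n, mul_smul, ih x hx, smul_zero]

/-- If `a` kills `F` then `#(F/aF) = #F`. [folklore] -/
theorem natCard_quotient_smul_top_eq_natCard_of_smul_eq_zero (F : Submodule (IwasawaAlgebra p) M) {a : IwasawaAlgebra p} (ha : ∀ x ∈ F, a • x = 0) :
    Nat.card (F ⧸ (Ideal.span {a} • ⊤ : Submodule (IwasawaAlgebra p) F)) = Nat.card F := by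
  have hbot : (Ideal.span {a} • ⊤ : Submodule (IwasawaAlgebra p) F) = ⊥ := by
    refine eq_bot_iff.mpr (Submodule.smul_le.mpr fun r hr x _ ↦ ?_)
    obtain ⟨c, rfl⟩ := Ideal.mem_span_singleton'.mp hr
    rw [Submodule.mem_bot, mul_smul, Subtype.ext_iff, Submodule.coe_smul, Submodule.coe_smul, ha x x.2, smul_zero, Submodule.coe_zero]
  exact Nat.card_congr (Submodule.quotEquivOfEqBot _ hbot).toEquiv

/-! ## §1 `#(X/ω_nX) = #(X'/ω_nX') · #(F/ω_nF)` in a rank-`0` tower -/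

section RankZero

/-- **`#(X/ω_nX) = #((X/F)/ω_n(X/F)) · #(F/ω_nF)`** for `X` f.g. torsion, `char_Λ X = (f)`, `F ≤ X` finite with `X/F` free of finite submodules, `f(0) ≠ 0` and `Ψ_m ∤ f`
for `m < n` (`ω_n` is `X/F`-regular, so `F ∩ ω_nX = ω_nF`). [cite: Washington1997, §13.3 (Lemma 13.18, Thm. 13.13)] [cite: GreenbergLNM1716, Prop. 4.14–4.15] -/
theorem natCard_quotient_omega_eq_mul [Module.Finite (IwasawaAlgebra p) M] (hM : Module.IsTorsion (IwasawaAlgebra p) M)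
    (F : Submodule (IwasawaAlgebra p) M) [Finite F] (hF : ∀ N : Submodule (IwasawaAlgebra p) (M ⧸ F), Finite N → N = ⊥) {f : IwasawaAlgebra p}
    (hchar : Literature.NumberTheory.EllipticCurves.Module.charIdeal (IwasawaAlgebra p) M = Ideal.span {f}) (h0 : PowerSeries.constantCoeff f ≠ 0) {n : ℕ}
    (hΨ : ∀ m < n, ¬ ((((Polynomial.cyclotomic (p ^ (m + 1)) ℤ_[p]).comp (Polynomial.X + 1) : ℤ_[p][X]) : IwasawaAlgebra p) ∣ f)) :
    Nat.card (M ⧸ (Ideal.span {((1 + PowerSeries.X : PowerSeries ℤ_[p]) ^ (p ^ n) - 1 : IwasawaAlgebra p)} • ⊤ : Submodule (IwasawaAlgebra p) M)) =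
      Nat.card ((M ⧸ F) ⧸ (Ideal.span {((1 + PowerSeries.X : PowerSeries ℤ_[p]) ^ (p ^ n) - 1 : IwasawaAlgebra p)} • ⊤ : Submodule (IwasawaAlgebra p) (M ⧸ F))) *
        Nat.card (F ⧸ (Ideal.span {((1 + PowerSeries.X : PowerSeries ℤ_[p]) ^ (p ^ n) - 1 : IwasawaAlgebra p)} • ⊤ : Submodule (IwasawaAlgebra p) F)) := by
  obtain ⟨hM', hchar'⟩ := isTorsion_and_charIdeal_quotient_eq hM F
  rw [hchar] at hchar'
  have hkill : ∀ x : M ⧸ F, f • x = 0 := smul_eq_zero_of_charIdeal_eq_span_of_noFiniteSubmodule p (M ⧸ F) hM' hF hchar'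
  exact natCard_quotient_smul_top_eq_mul_of_quotient_regular F _ (omega_smul_eq_zero_imp hF hkill h0 hΨ)

/-! ## §2 The exact one-step law with the finite-submodule correction -/

/-- ★★★ **IWASAWA'S ONE-STEP GROWTH LAW WITH THE FINITE SUBMODULE PRESENT.** `X` ANY finitely generated torsion `Λ`-module, `char_Λ X = (f)`, `F ≤ X` finite with
`X/F` free of finite submodules; rank-`0` tower: `f(0) ≠ 0`, `Ψ_m ∤ f` for `m < n`; `λ(f) < pⁿ(p−1)`. Then
**`#(X/ω_{n+1}X) · #(F/ω_nF) = p^{pⁿ(p−1)·μ(f) + λ(f)} · #(X/ω_nX) · #(F/ω_{n+1}F)`** — the growth number `#(X/ω_{n+1}X)/#(X/ω_nX)` is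
`p^{pⁿ(p−1)μ+λ} · #(ω_nF/ω_{n+1}F)`. [cite: Washington1997, §13.3 (Thm. 13.13)] [cite: NeukirchSchmidtWingberg2008, (5.3.17)] [cite: GreenbergLNM1716, §4 p. 117] -/
theorem natCard_quotient_omega_succ_mul_eq [Module.Finite (IwasawaAlgebra p) M] (hM : Module.IsTorsion (IwasawaAlgebra p) M)
    (F : Submodule (IwasawaAlgebra p) M) [Finite F] (hF : ∀ N : Submodule (IwasawaAlgebra p) (M ⧸ F), Finite N → N = ⊥) {f : IwasawaAlgebra p}
    (hchar : Literature.NumberTheory.EllipticCurves.Module.charIdeal (IwasawaAlgebra p) M = Ideal.span {f}) (h0 : PowerSeries.constantCoeff f ≠ 0) {n : ℕ}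
    (hΨ : ∀ m < n, ¬ ((((Polynomial.cyclotomic (p ^ (m + 1)) ℤ_[p]).comp (Polynomial.X + 1) : ℤ_[p][X]) : IwasawaAlgebra p) ∣ f))
    (hlam : lam f < p ^ n * (p - 1)) :
    Nat.card (M ⧸ (Ideal.span {((1 + PowerSeries.X : PowerSeries ℤ_[p]) ^ (p ^ (n + 1)) - 1 : IwasawaAlgebra p)} • ⊤ : Submodule (IwasawaAlgebra p) M)) *
        Nat.card (F ⧸ (Ideal.span {((1 + PowerSeries.X : PowerSeries ℤ_[p]) ^ (p ^ n) - 1 : IwasawaAlgebra p)} • ⊤ : Submodule (IwasawaAlgebra p) F)) =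
      p ^ (p ^ n * (p - 1) * mu f + lam f) *
        Nat.card (M ⧸ (Ideal.span {((1 + PowerSeries.X : PowerSeries ℤ_[p]) ^ (p ^ n) - 1 : IwasawaAlgebra p)} • ⊤ : Submodule (IwasawaAlgebra p) M)) *
          Nat.card (F ⧸ (Ideal.span {((1 + PowerSeries.X : PowerSeries ℤ_[p]) ^ (p ^ (n + 1)) - 1 : IwasawaAlgebra p)} • ⊤ : Submodule (IwasawaAlgebra p) F)) := by
  have hf0 : f ≠ 0 := fun h ↦ h0 (by rw [h, map_zero])
  obtain ⟨hM', hchar'⟩ := isTorsion_and_charIdeal_quotient_eq hM F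
  rw [hchar] at hchar'
  have hkill : ∀ x : M ⧸ F, f • x = 0 := smul_eq_zero_of_charIdeal_eq_span_of_noFiniteSubmodule p (M ⧸ F) hM' hF hchar'
  -- `Ψ_m ∤ f` also at `m = n` (the layer is high), hence `ω_{n+1}` is `X/F`-regular as well
  have hΨ' : ∀ m < n + 1, ¬ ((((Polynomial.cyclotomic (p ^ (m + 1)) ℤ_[p]).comp (Polynomial.X + 1) : ℤ_[p][X]) : IwasawaAlgebra p) ∣ f) := by
    intro m hm
    by_cases hmn : m < n
    · exact hΨ m hmn
    · have hmn' : m = n := by omega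
      subst hmn'
      exact not_cyclotomicLayer_dvd_of_lam_lt hf0 hlam le_rfl
  have e1 := natCard_quotient_omega_eq_mul hM F hF hchar h0 hΨ'
  have e2 := natCard_quotient_omega_eq_mul hM F hF hchar h0 hΨ
  -- on `X' = X/F`: `#(X'/ω_{n+1}X') = #(X'/ω_nX') · #(X'/Ψ_nX')` and `#(X'/Ψ_nX') = p^{pⁿ(p−1)μ+λ}`
  have e3 : Nat.card ((M ⧸ F) ⧸ (Ideal.span {((1 + PowerSeries.X : PowerSeries ℤ_[p]) ^ (p ^ (n + 1)) - 1 : IwasawaAlgebra p)} • ⊤ :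
        Submodule (IwasawaAlgebra p) (M ⧸ F))) =
      Nat.card ((M ⧸ F) ⧸ (Ideal.span {((1 + PowerSeries.X : PowerSeries ℤ_[p]) ^ (p ^ n) - 1 : IwasawaAlgebra p)} • ⊤ : Submodule (IwasawaAlgebra p) (M ⧸ F))) *
        p ^ (p ^ n * (p - 1) * mu f + lam f) := by
    rw [← coe_cyclotomicLayer_mul_omega p n, natCard_quotient_span_mul_smul_top' _ _ (omega_smul_eq_zero_imp hF hkill h0 hΨ),
      natCard_layerQuotient_eq_pow hM' hF hchar' hlam]
  rw [e1, e2, e3]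
  ring

/-! ## §3 Past the finite submodule: the law is exact -/

/-- ★★★ **`#(X/ω_{n+1}X) = p^{pⁿ(p−1)·μ(f) + λ(f)} · #(X/ω_nX)` EXACTLY, for EVERY finitely generated torsion `X`** (finite submodule allowed) in a rank-`0` tower
(`f(0) ≠ 0`, `Ψ_m ∤ f` for `m < n`), at every layer `n` with `λ(f) < pⁿ(p−1)` and `ω_n F = 0` (`F` the finite part as in §2). NO «no finite submodule» hypothesis:
the growth number `g_n = p^{pⁿ(p−1)μ+λ}` reads `(μ, λ)` off two consecutive `ω`-coinvariant indices. [cite: Washington1997, §13.3 (Thm. 13.13)]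
[cite: GreenbergLNM1716, Thm. 1.10 and Prop. 4.14–4.15] -/
theorem natCard_quotient_omega_succ_eq_pow_mul [Module.Finite (IwasawaAlgebra p) M] (hM : Module.IsTorsion (IwasawaAlgebra p) M)
    (F : Submodule (IwasawaAlgebra p) M) [Finite F] (hF : ∀ N : Submodule (IwasawaAlgebra p) (M ⧸ F), Finite N → N = ⊥) {f : IwasawaAlgebra p}
    (hchar : Literature.NumberTheory.EllipticCurves.Module.charIdeal (IwasawaAlgebra p) M = Ideal.span {f}) (h0 : PowerSeries.constantCoeff f ≠ 0) {n : ℕ}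
    (hΨ : ∀ m < n, ¬ ((((Polynomial.cyclotomic (p ^ (m + 1)) ℤ_[p]).comp (Polynomial.X + 1) : ℤ_[p][X]) : IwasawaAlgebra p) ∣ f))
    (hlam : lam f < p ^ n * (p - 1)) (hFω : ∀ x ∈ F, (((1 + PowerSeries.X : PowerSeries ℤ_[p]) ^ (p ^ n) - 1 : IwasawaAlgebra p)) • x = 0) :
    Nat.card (M ⧸ (Ideal.span {((1 + PowerSeries.X : PowerSeries ℤ_[p]) ^ (p ^ (n + 1)) - 1 : IwasawaAlgebra p)} • ⊤ : Submodule (IwasawaAlgebra p) M)) =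
      p ^ (p ^ n * (p - 1) * mu f + lam f) *
        Nat.card (M ⧸ (Ideal.span {((1 + PowerSeries.X : PowerSeries ℤ_[p]) ^ (p ^ n) - 1 : IwasawaAlgebra p)} • ⊤ : Submodule (IwasawaAlgebra p) M)) := by
  have h := natCard_quotient_omega_succ_mul_eq hM F hF hchar h0 hΨ hlam
  rw [natCard_quotient_smul_top_eq_natCard_of_smul_eq_zero F hFω,
    natCard_quotient_smul_top_eq_natCard_of_smul_eq_zero F (omega_smul_eq_zero_of_le F hFω (Nat.le_succ n))] at h
  have hFpos : 0 < Nat.card F := Nat.card_pos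
  exact Nat.eq_of_mul_eq_mul_right hFpos h

/-- The same, `μ`-invariant OF THE MODULE in the exponent (`μ(X) = μ(f)`, tree `mu_generator_eq_muInvariant`). [cite: Washington1997, §13.2–13.3] -/
theorem natCard_quotient_omega_succ_eq_pow_muInvariant_mul [Module.Finite (IwasawaAlgebra p) M] (hM : Module.IsTorsion (IwasawaAlgebra p) M)
    (F : Submodule (IwasawaAlgebra p) M) [Finite F] (hF : ∀ N : Submodule (IwasawaAlgebra p) (M ⧸ F), Finite N → N = ⊥) {f : IwasawaAlgebra p}
    (hchar : Literature.NumberTheory.EllipticCurves.Module.charIdeal (IwasawaAlgebra p) M = Ideal.span {f}) (h0 : PowerSeries.constantCoeff f ≠ 0) {n : ℕ}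
    (hΨ : ∀ m < n, ¬ ((((Polynomial.cyclotomic (p ^ (m + 1)) ℤ_[p]).comp (Polynomial.X + 1) : ℤ_[p][X]) : IwasawaAlgebra p) ∣ f))
    (hlam : lam f < p ^ n * (p - 1)) (hFω : ∀ x ∈ F, (((1 + PowerSeries.X : PowerSeries ℤ_[p]) ^ (p ^ n) - 1 : IwasawaAlgebra p)) • x = 0) :
    Nat.card (M ⧸ (Ideal.span {((1 + PowerSeries.X : PowerSeries ℤ_[p]) ^ (p ^ (n + 1)) - 1 : IwasawaAlgebra p)} • ⊤ : Submodule (IwasawaAlgebra p) M)) =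
      p ^ (p ^ n * (p - 1) * muInvariant p M + lam f) *
        Nat.card (M ⧸ (Ideal.span {((1 + PowerSeries.X : PowerSeries ℤ_[p]) ^ (p ^ n) - 1 : IwasawaAlgebra p)} • ⊤ : Submodule (IwasawaAlgebra p) M)) := by
  have hf0 : f ≠ 0 := fun h ↦ h0 (by rw [h, map_zero])
  rw [← Summit.BirchSwinnertonDyer.Rank1Residual.X1.MuPart.mu_generator_eq_muInvariant M hM hf0 hchar]
  exact natCard_quotient_omega_succ_eq_pow_mul hM F hF hchar h0 hΨ hlam hFω

/-! ## §4 Iwasawa's theorem, exact from an explicit layer, for EVERY finitely generated torsion module in a rank-`0` tower -/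

/-- ★★★ **IWASAWA'S THEOREM WITHOUT THE «NO FINITE SUBMODULE» HYPOTHESIS.** `X` ANY finitely generated torsion `Λ`-module, `char_Λ X = (f)`, `F ≤ X` finite with `X/F`
free of finite submodules; rank-`0` tower `f(0) ≠ 0`, `Ψ_m ∤ f` for `m < n₁`; `λ(f) < p^{n₁}(p−1)` and `ω_{n₁} F = 0`. Then for every `n ≥ n₁`:
**`#(X/ω_nX) · p^{μ(f)p^{n₁} + λ(f)n₁} = #(X/ω_{n₁}X) · p^{μ(f)pⁿ + λ(f)n}`** — `e_n = μpⁿ + λn + ν` for ALL `n ≥ n₁` with `ν = e_{n₁} − μp^{n₁} − λn₁`.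
[cite: Washington1997, §13.3 Thm. 13.13] [cite: GreenbergLNM1716, Thm. 1.10] [cite: Lang1990, Ch. 5 Thm. 1.2] -/
theorem natCard_quotient_omega_mul_pow_eq' [Module.Finite (IwasawaAlgebra p) M] (hM : Module.IsTorsion (IwasawaAlgebra p) M)
    (F : Submodule (IwasawaAlgebra p) M) [Finite F] (hF : ∀ N : Submodule (IwasawaAlgebra p) (M ⧸ F), Finite N → N = ⊥) {f : IwasawaAlgebra p}
    (hchar : Literature.NumberTheory.EllipticCurves.Module.charIdeal (IwasawaAlgebra p) M = Ideal.span {f}) (h0 : PowerSeries.constantCoeff f ≠ 0) {n₁ : ℕ}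
    (hΨ : ∀ m < n₁, ¬ ((((Polynomial.cyclotomic (p ^ (m + 1)) ℤ_[p]).comp (Polynomial.X + 1) : ℤ_[p][X]) : IwasawaAlgebra p) ∣ f))
    (hlam : lam f < p ^ n₁ * (p - 1)) (hFω : ∀ x ∈ F, (((1 + PowerSeries.X : PowerSeries ℤ_[p]) ^ (p ^ n₁) - 1 : IwasawaAlgebra p)) • x = 0)
    {n : ℕ} (hn : n₁ ≤ n) :
    Nat.card (M ⧸ (Ideal.span {((1 + PowerSeries.X : PowerSeries ℤ_[p]) ^ (p ^ n) - 1 : IwasawaAlgebra p)} • ⊤ : Submodule (IwasawaAlgebra p) M)) *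
        p ^ (mu f * p ^ n₁ + lam f * n₁) =
      Nat.card (M ⧸ (Ideal.span {((1 + PowerSeries.X : PowerSeries ℤ_[p]) ^ (p ^ n₁) - 1 : IwasawaAlgebra p)} • ⊤ : Submodule (IwasawaAlgebra p) M)) *
        p ^ (mu f * p ^ n + lam f * n) := by
  have hf0 : f ≠ 0 := fun h ↦ h0 (by rw [h, map_zero])
  have hΨall := forall_not_cyclotomicLayer_dvd hf0 hlam hΨ
  induction n, hn using Nat.le_induction with
  | base => rfl
  | succ n hmn ih =>
    have hstep := natCard_quotient_omega_succ_eq_pow_mul hM F hF hchar h0 (fun m _ ↦ hΨall m)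
      (hlam.trans_le (Nat.mul_le_mul_right _ (Nat.pow_le_pow_right hp.out.pos hmn))) (omega_smul_eq_zero_of_le F hFω hmn)
    have key : Nat.card (M ⧸ (Ideal.span {((1 + PowerSeries.X : PowerSeries ℤ_[p]) ^ (p ^ (n + 1)) - 1 : IwasawaAlgebra p)} • ⊤ :
        Submodule (IwasawaAlgebra p) M)) * p ^ (mu f * p ^ n₁ + lam f * n₁) =
      Nat.card (M ⧸ (Ideal.span {((1 + PowerSeries.X : PowerSeries ℤ_[p]) ^ (p ^ n) - 1 : IwasawaAlgebra p)} • ⊤ :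
        Submodule (IwasawaAlgebra p) M)) * p ^ (mu f * p ^ n₁ + lam f * n₁) * p ^ (p ^ n * (p - 1) * mu f + lam f) := by
      rw [hstep]; ring
    rw [key, ih, mul_assoc, ← pow_add]
    congr 2
    have hp1 : 1 ≤ p := hp.out.one_lt.le
    have e : p ^ (n + 1) = p ^ n * (p - 1) + p ^ n := by
      have h2 : p ^ n * (p - 1) + p ^ n = p ^ n * (p - 1 + 1) := by ring
      rw [h2, Nat.sub_add_cancel hp1, pow_succ]
    rw [e]
    ring

/-- ★★ **`μ = 0`: THE INVARIANTS GROW BY EXACTLY `p^{λ}` PER LAYER from `n₁` on**, for EVERY finitely generated torsion `X` in a rank-`0` tower (same hypotheses with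
`μ(f) = 0`): `#(X/ω_{n+1}X) = p^{λ(f)} · #(X/ω_nX)` for all `n ≥ n₁`. [cite: Washington1997, §13.3 Thm. 13.13] [cite: GreenbergLNM1716, Thm. 1.10] -/
theorem natCard_quotient_omega_succ_eq_pow_lam_mul_of_mu_eq_zero [Module.Finite (IwasawaAlgebra p) M] (hM : Module.IsTorsion (IwasawaAlgebra p) M)
    (F : Submodule (IwasawaAlgebra p) M) [Finite F] (hF : ∀ N : Submodule (IwasawaAlgebra p) (M ⧸ F), Finite N → N = ⊥) {f : IwasawaAlgebra p}
    (hchar : Literature.NumberTheory.EllipticCurves.Module.charIdeal (IwasawaAlgebra p) M = Ideal.span {f}) (h0 : PowerSeries.constantCoeff f ≠ 0) {n₁ : ℕ}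
    (hΨ : ∀ m < n₁, ¬ ((((Polynomial.cyclotomic (p ^ (m + 1)) ℤ_[p]).comp (Polynomial.X + 1) : ℤ_[p][X]) : IwasawaAlgebra p) ∣ f))
    (hlam : lam f < p ^ n₁ * (p - 1)) (hFω : ∀ x ∈ F, (((1 + PowerSeries.X : PowerSeries ℤ_[p]) ^ (p ^ n₁) - 1 : IwasawaAlgebra p)) • x = 0)
    (hμ : mu f = 0) {n : ℕ} (hn : n₁ ≤ n) :
    Nat.card (M ⧸ (Ideal.span {((1 + PowerSeries.X : PowerSeries ℤ_[p]) ^ (p ^ (n + 1)) - 1 : IwasawaAlgebra p)} • ⊤ : Submodule (IwasawaAlgebra p) M)) =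
      p ^ lam f * Nat.card (M ⧸ (Ideal.span {((1 + PowerSeries.X : PowerSeries ℤ_[p]) ^ (p ^ n) - 1 : IwasawaAlgebra p)} • ⊤ : Submodule (IwasawaAlgebra p) M)) := by
  have hf0 : f ≠ 0 := fun h ↦ h0 (by rw [h, map_zero])
  have hΨall := forall_not_cyclotomicLayer_dvd hf0 hlam hΨ
  have h := natCard_quotient_omega_succ_eq_pow_mul hM F hF hchar h0 (fun m _ ↦ hΨall m)
    (hlam.trans_le (Nat.mul_le_mul_right _ (Nat.pow_le_pow_right hp.out.pos hn))) (omega_smul_eq_zero_of_le F hFω hn)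
  rwa [hμ, mul_zero, zero_add] at h

end RankZero

end Summit.BirchSwinnertonDyer.BirchSwinnertonDyer.Theorems.AlignedTransportAtTwoHalfDescentLayerIndexGrowthExact

end
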